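import Mathlib
import Summits.Ventures.PercRepro2.Tail2DBlockCalc
import Summits.Ventures.PercRepro2.Tail2DHarrisSP
import Summits.Ventures.PercRepro2.Tail2DFlowOneBlocks
import Summits.Ventures.PercRepro2.Tail2DStochDomLeafPar

/-!
# (SD) on `X ∥ Y` for two flow-one networks, from Harris alone
(seat mine-b, cell pub-perc-repro2; conjectures/MINE-B.md §42)

A FLOW-ONE network has `r + b ≤ 1` on every configuration, so its labels are `(1,0)` (a red crossing, `R`),
`(0,1)` (a blue crossing, `B`) and `(0,0)` (no crossing, `C`).  Its six blocks `R`, `B`, `all`, `C`, the row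
`{b = 0} = R ⊔ C` and the column `{r = 0} = B ⊔ C` are related by Harris alone (`R`, the row are lower sets; `B`,
the column are upper sets): `R ≼ B`, `R ≼ all`, `all ≼ B`, `row ≼ all`, `all ≼ col`, `R ≼ col`, `row ≼ B`.
For `Z = X ∥ Y` with both factors flow-one (so `r + b ≤ 2` on `Z`), (SD) at every clipped position follows from
these dominations by seven symbolic block certificates whose weights are rational functions of the four counts
`a = #R_X`, `n = #all_X`, `a' = #R_Y`, `n' = #all_Y` (`#B = #R` by the colour swap, `tailCount_symm`).
The hard position `(1,0)`: `E(1,0) = R × all ⊔ col × R'` against `E(0,1) = B × all ⊔ row × B'`, both of size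
`L = a n' + (n − a) a'`; the plan keeps `R × B'`, moves `R × C'` to `B × C'` (`R ≼ B`), and splits `all × R'` into
`B × R'` (mass `a a'/L`, `all ≼ B`) and `col × B'` (mass `(n − a) a'/L`, `all ≼ col` and `R' ≼ B'`).
This is the first INFINITE family of parallel compositions without single-edge factors on which (SD) is a theorem
(e.g. every `P_j ∥ P_k`, `(e ∧ (e ∥ e)) ∥ P_k`), and the proof uses nothing about the factors beyond Harris.
-/

namespace Summit.Ventures.PercRepro2.Tail2D

open V2Closure Finset

section Certificates

variable (s t : V2Closure.SP)

/-- **the certificate at `(1,0)`**: `E(1,0) = R × all ⊔ col × R' ≼ E(0,1) = B × all ⊔ row × B'` — keep `R × B'`,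
move `R × row'` to `B × row'` (`R ≼ B`) and `col × R'` to `col × B'` (`R' ≼ B'`) -/
theorem cert_10 (hs : FlowOne s) (ht : FlowOne t) (ha : 0 < (rSet s).card) (ha' : 0 < (rSet t).card) :
    BlockDom (V2Closure.SP.par s t) (tailSet (V2Closure.SP.par s t) 1 0) (tailSet (V2Closure.SP.par s t) 0 1) := by
  obtain ⟨hB, hC, -, hn, hRne, hBne, hCne, -⟩ := counts s hs ha
  obtain ⟨hB', -, hRow', hn', hR'ne, hB'ne, -, hRow'ne⟩ := counts t ht ha'
  have hLe := card_rSet_le s; have hLe' := card_rSet_le t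
  have hsym := tailCount_par_symm s t 1 0
  have hLq : (0 : ℚ) < (tailCount (V2Closure.SP.par s t) 1 0 : ℚ) := by exact_mod_cast tailCount_par_10_pos s t ha
  have hL0 : (tailCount (V2Closure.SP.par s t) 1 0 : ℚ) ≠ 0 := ne_of_gt hLq
  have ha0 : ((rSet s).card : ℚ) ≠ 0 := by exact_mod_cast ne_of_gt ha
  have ha'0 : ((rSet t).card : ℚ) ≠ 0 := by exact_mod_cast ne_of_gt ha'
  have hd0 : (Fintype.card s.Conf : ℚ) - (rSet s).card ≠ 0 := by
    have : ((rSet s).card : ℚ) < Fintype.card s.Conf := by exact_mod_cast hn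
    linarith
  have hd0' : (Fintype.card t.Conf : ℚ) - (rSet t).card ≠ 0 := by
    have : ((rSet t).card : ℚ) < Fintype.card t.Conf := by exact_mod_cast hn'
    linarith
  refine blockDom_par_of_certificate s t
      ![rSet s, rSet s, colSet s] ![bSet s, rSet s, colSet s]
      ![rowSet t 0, bSet t, rSet t] ![rowSet t 0, bSet t, bSet t]
      ![((rSet s).card * (Fintype.card t.Conf - (rSet t).card) : ℕ) / (tailCount (V2Closure.SP.par s t) 1 0 : ℕ),
        ((rSet s).card * (rSet t).card : ℕ) / (tailCount (V2Closure.SP.par s t) 1 0 : ℕ),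
        ((Fintype.card s.Conf - (rSet s).card) * (rSet t).card : ℕ) / (tailCount (V2Closure.SP.par s t) 1 0 : ℕ)]
      ?_ ?_ ?_ ?_ _ _ ?_ ?_
  · intro k; fin_cases k <;> simp <;> positivity
  · intro k; fin_cases k <;> simp [blockDom_refl, dom_r_b]
  · intro k; fin_cases k <;> simp [blockDom_refl, dom_r_b]
  · intro k _ _
    rcases k with ⟨k, hk⟩
    interval_cases k
    · exact Finset.nonempty_product.2 ⟨hBne, hRow'ne⟩
    · exact Finset.nonempty_product.2 ⟨hRne, hB'ne⟩
    · exact Finset.nonempty_product.2 ⟨hCne, hB'ne⟩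
  · rintro ⟨x, y⟩
    simp only [Fin.sum_univ_succ, Fin.sum_univ_zero, Matrix.cons_val_zero, Matrix.cons_val_succ,
      unifDens_par_prod, unifDens_par_tail, mem_rSet, mem_bSet, mem_colSet, mem_rowSet0]
    rcases flowOne_cases s hs x with hx | hx | hx <;> rcases flowOne_cases t ht y with hy | hy | hy <;>
      simp only [hx.1, hx.2, hy.1, hy.2, hB', hC, hRow'] <;> norm_num <;> push_cast [hLe, hLe'] <;>
      field_simp
  · rintro ⟨x, y⟩
    simp only [Fin.sum_univ_succ, Fin.sum_univ_zero, Matrix.cons_val_zero, Matrix.cons_val_succ,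
      unifDens_par_prod, unifDens_par_tail, mem_rSet, mem_bSet, mem_colSet, mem_rowSet0, ← hsym]
    rcases flowOne_cases s hs x with hx | hx | hx <;> rcases flowOne_cases t ht y with hy | hy | hy <;>
      simp only [hx.1, hx.2, hy.1, hy.2, hB', hB, hC, hRow'] <;> norm_num <;> push_cast [hLe, hLe'] <;>
      field_simp

/-- **the certificate at `(2,0)`**: `R × R' ≼ R × B' ⊔ B × R'` -/
theorem cert_20 (hs : FlowOne s) (ht : FlowOne t) (ha : 0 < (rSet s).card) (ha' : 0 < (rSet t).card) :
    BlockDom (V2Closure.SP.par s t) (tailSet (V2Closure.SP.par s t) 2 0) (tailSet (V2Closure.SP.par s t) 1 1) := by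
  obtain ⟨hB, -, -, -, hRne, hBne, -, -⟩ := counts s hs ha
  obtain ⟨hB', -, -, -, hR'ne, hB'ne, -, -⟩ := counts t ht ha'
  have ha0 : ((rSet s).card : ℚ) ≠ 0 := by exact_mod_cast ne_of_gt ha
  have ha'0 : ((rSet t).card : ℚ) ≠ 0 := by exact_mod_cast ne_of_gt ha'
  refine blockDom_par_of_certificate s t ![rSet s, rSet s] ![rSet s, bSet s] ![rSet t, rSet t] ![bSet t, rSet t]
      ![1/2, 1/2] ?_ ?_ ?_ ?_ _ _ ?_ ?_
  · intro k; fin_cases k <;> norm_num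
  · intro k; fin_cases k <;> simp [blockDom_refl, dom_r_b]
  · intro k; fin_cases k <;> simp [blockDom_refl, dom_r_b]
  · intro k _ _
    rcases k with ⟨k, hk⟩
    interval_cases k
    · exact Finset.nonempty_product.2 ⟨hRne, hB'ne⟩
    · exact Finset.nonempty_product.2 ⟨hBne, hR'ne⟩
  · rintro ⟨x, y⟩
    simp only [Fin.sum_univ_succ, Fin.sum_univ_zero, Matrix.cons_val_zero, Matrix.cons_val_succ,
      unifDens_par_prod, unifDens_par_tail, mem_rSet, tailCount_par_20 s t hs ht]
    rcases flowOne_cases s hs x with hx | hx | hx <;> rcases flowOne_cases t ht y with hy | hy | hy <;>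
      (simp only [hx.1, hx.2, hy.1, hy.2]; first | (norm_num; done) | (norm_num; field_simp; norm_num))
  · rintro ⟨x, y⟩
    simp only [Fin.sum_univ_succ, Fin.sum_univ_zero, Matrix.cons_val_zero, Matrix.cons_val_succ,
      unifDens_par_prod, unifDens_par_tail, mem_rSet, mem_bSet, tailCount_par_11 s t hs ht]
    rcases flowOne_cases s hs x with hx | hx | hx <;> rcases flowOne_cases t ht y with hy | hy | hy <;>
      simp only [hx.1, hx.2, hy.1, hy.2, hB', hB] <;> norm_num <;> field_simp

/-- **the certificate at `(1,1)`**: `R × B' ⊔ B × R' ≼ B × B'` -/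
theorem cert_11 (hs : FlowOne s) (ht : FlowOne t) (ha : 0 < (rSet s).card) (ha' : 0 < (rSet t).card) :
    BlockDom (V2Closure.SP.par s t) (tailSet (V2Closure.SP.par s t) 1 1) (tailSet (V2Closure.SP.par s t) 0 2) := by
  obtain ⟨hB, -, -, -, -, hBne, -, -⟩ := counts s hs ha
  obtain ⟨hB', -, -, -, -, hB'ne, -, -⟩ := counts t ht ha'
  have ha0 : ((rSet s).card : ℚ) ≠ 0 := by exact_mod_cast ne_of_gt ha
  have ha'0 : ((rSet t).card : ℚ) ≠ 0 := by exact_mod_cast ne_of_gt ha'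
  refine blockDom_par_of_certificate s t ![rSet s, bSet s] ![bSet s, bSet s] ![bSet t, rSet t] ![bSet t, bSet t]
      ![1/2, 1/2] ?_ ?_ ?_ ?_ _ _ ?_ ?_
  · intro k; fin_cases k <;> norm_num
  · intro k; fin_cases k <;> simp [blockDom_refl, dom_r_b]
  · intro k; fin_cases k <;> simp [blockDom_refl, dom_r_b]
  · intro k _ _
    rcases k with ⟨k, hk⟩
    interval_cases k <;> exact Finset.nonempty_product.2 ⟨hBne, hB'ne⟩
  · rintro ⟨x, y⟩
    simp only [Fin.sum_univ_succ, Fin.sum_univ_zero, Matrix.cons_val_zero, Matrix.cons_val_succ,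
      unifDens_par_prod, unifDens_par_tail, mem_rSet, mem_bSet, tailCount_par_11 s t hs ht]
    rcases flowOne_cases s hs x with hx | hx | hx <;> rcases flowOne_cases t ht y with hy | hy | hy <;>
      simp only [hx.1, hx.2, hy.1, hy.2, hB', hB] <;> norm_num <;> field_simp
  · rintro ⟨x, y⟩
    simp only [Fin.sum_univ_succ, Fin.sum_univ_zero, Matrix.cons_val_zero, Matrix.cons_val_succ,
      unifDens_par_prod, unifDens_par_tail, mem_bSet, tailCount_par_02 s t hs ht]
    rcases flowOne_cases s hs x with hx | hx | hx <;> rcases flowOne_cases t ht y with hy | hy | hy <;>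
      (simp only [hx.1, hx.2, hy.1, hy.2, hB', hB]; first | (norm_num; done) | (norm_num; field_simp; norm_num))

/-- **the certificate at `(0,1)`**: `B × all ⊔ row × B' ≼ B × B'` (Harris on each part) -/
theorem cert_01 (hs : FlowOne s) (ht : FlowOne t) (ha : 0 < (rSet s).card) (ha' : 0 < (rSet t).card) :
    BlockDom (V2Closure.SP.par s t) (tailSet (V2Closure.SP.par s t) 0 1) (tailSet (V2Closure.SP.par s t) 0 2) := by
  obtain ⟨hB, -, hRow, hn, -, hBne, -, hRowne⟩ := counts s hs ha
  obtain ⟨hB', -, -, -, -, hB'ne, -, -⟩ := counts t ht ha'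
  have hLe := card_rSet_le s
  have hL : tailCount (V2Closure.SP.par s t) 0 1
      = (rSet s).card * Fintype.card t.Conf + (Fintype.card s.Conf - (rSet s).card) * (rSet t).card := by
    rw [← tailCount_par_symm, tailCount_par_10 s t hs ht]
  have hLq : (0 : ℚ) < (tailCount (V2Closure.SP.par s t) 0 1 : ℚ) := by
    rw [← tailCount_par_symm]; exact_mod_cast tailCount_par_10_pos s t ha
  have hL0 : (tailCount (V2Closure.SP.par s t) 0 1 : ℚ) ≠ 0 := ne_of_gt hLq
  have ha0 : ((rSet s).card : ℚ) ≠ 0 := by exact_mod_cast ne_of_gt ha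
  have ha'0 : ((rSet t).card : ℚ) ≠ 0 := by exact_mod_cast ne_of_gt ha'
  have hn0 : (Fintype.card t.Conf : ℚ) ≠ 0 := by
    have := card_rSet_le t; exact_mod_cast ne_of_gt (lt_of_lt_of_le ha' this)
  have hd0 : (Fintype.card s.Conf : ℚ) - (rSet s).card ≠ 0 := by
    have : ((rSet s).card : ℚ) < Fintype.card s.Conf := by exact_mod_cast hn
    linarith
  refine blockDom_par_of_certificate s t ![bSet s, rowSet s 0] ![bSet s, bSet s]
      ![Finset.univ, bSet t] ![bSet t, bSet t]
      ![((rSet s).card * Fintype.card t.Conf : ℕ) / (tailCount (V2Closure.SP.par s t) 0 1 : ℕ),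
        ((Fintype.card s.Conf - (rSet s).card) * (rSet t).card : ℕ) / (tailCount (V2Closure.SP.par s t) 0 1 : ℕ)]
      ?_ ?_ ?_ ?_ _ _ ?_ ?_
  · intro k; fin_cases k <;> simp <;> positivity
  · intro k; fin_cases k <;> simp [blockDom_refl, dom_row_b]
  · intro k; fin_cases k <;> simp [blockDom_refl, dom_univ_b]
  · intro k _ _
    rcases k with ⟨k, hk⟩
    interval_cases k <;> exact Finset.nonempty_product.2 ⟨hBne, hB'ne⟩
  · rintro ⟨x, y⟩
    simp only [Fin.sum_univ_succ, Fin.sum_univ_zero, Matrix.cons_val_zero, Matrix.cons_val_succ,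
      unifDens_par_prod, unifDens_par_tail, mem_bSet, mem_rowSet0, Finset.mem_univ, Finset.card_univ]
    rcases flowOne_cases s hs x with hx | hx | hx <;> rcases flowOne_cases t ht y with hy | hy | hy <;>
      simp only [hx.1, hx.2, hy.1, hy.2, hB, hB', hRow] <;> norm_num <;> push_cast [hLe] <;> field_simp
  · rintro ⟨x, y⟩
    simp only [Fin.sum_univ_succ, Fin.sum_univ_zero, Matrix.cons_val_zero, Matrix.cons_val_succ,
      unifDens_par_prod, unifDens_par_tail, mem_bSet, tailCount_par_02 s t hs ht]
    rcases flowOne_cases s hs x with hx | hx | hx <;> rcases flowOne_cases t ht y with hy | hy | hy <;>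
      (simp only [hx.1, hx.2, hy.1, hy.2, hB, hB'];
       first | (norm_num; done) | (norm_num; push_cast [hLe]; field_simp; rw [hL]; push_cast [hLe]; ring))

/-- **the certificate at `(2,−1)`**: `R × R' ≼ E(1,0) = R × all ⊔ col × R'` (Harris on each part) -/
theorem cert_2m (hs : FlowOne s) (ht : FlowOne t) (ha : 0 < (rSet s).card) (ha' : 0 < (rSet t).card) :
    BlockDom (V2Closure.SP.par s t) (tailSet (V2Closure.SP.par s t) 2 0) (tailSet (V2Closure.SP.par s t) 1 0) := by
  obtain ⟨-, hC, -, hn, hRne, -, hCne, -⟩ := counts s hs ha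
  obtain ⟨-, -, -, -, hR'ne, -, -, -⟩ := counts t ht ha'
  have hLe := card_rSet_le s
  have hL := tailCount_par_10 s t hs ht
  have hLq : (0 : ℚ) < (tailCount (V2Closure.SP.par s t) 1 0 : ℚ) := by exact_mod_cast tailCount_par_10_pos s t ha
  have hL0 : (tailCount (V2Closure.SP.par s t) 1 0 : ℚ) ≠ 0 := ne_of_gt hLq
  have ha0 : ((rSet s).card : ℚ) ≠ 0 := by exact_mod_cast ne_of_gt ha
  have ha'0 : ((rSet t).card : ℚ) ≠ 0 := by exact_mod_cast ne_of_gt ha'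
  have hn0 : (Fintype.card t.Conf : ℚ) ≠ 0 := by
    have := card_rSet_le t; exact_mod_cast ne_of_gt (lt_of_lt_of_le ha' this)
  have hd0 : (Fintype.card s.Conf : ℚ) - (rSet s).card ≠ 0 := by
    have : ((rSet s).card : ℚ) < Fintype.card s.Conf := by exact_mod_cast hn
    linarith
  refine blockDom_par_of_certificate s t ![rSet s, rSet s] ![rSet s, colSet s] ![rSet t, rSet t]
      ![Finset.univ, rSet t]
      ![((rSet s).card * Fintype.card t.Conf : ℕ) / (tailCount (V2Closure.SP.par s t) 1 0 : ℕ),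
        ((Fintype.card s.Conf - (rSet s).card) * (rSet t).card : ℕ) / (tailCount (V2Closure.SP.par s t) 1 0 : ℕ)]
      ?_ ?_ ?_ ?_ _ _ ?_ ?_
  · intro k; fin_cases k <;> simp <;> positivity
  · intro k; fin_cases k <;> simp [blockDom_refl, dom_r_col]
  · intro k; fin_cases k <;> simp [blockDom_refl, dom_r_univ]
  · intro k _ _
    rcases k with ⟨k, hk⟩
    interval_cases k
    · exact Finset.nonempty_product.2 ⟨hRne, Finset.univ_nonempty_iff.2 ⟨redConf t⟩⟩
    · exact Finset.nonempty_product.2 ⟨hCne, hR'ne⟩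
  · rintro ⟨x, y⟩
    simp only [Fin.sum_univ_succ, Fin.sum_univ_zero, Matrix.cons_val_zero, Matrix.cons_val_succ,
      unifDens_par_prod, unifDens_par_tail, mem_rSet, tailCount_par_20 s t hs ht]
    rcases flowOne_cases s hs x with hx | hx | hx <;> rcases flowOne_cases t ht y with hy | hy | hy <;>
      (simp only [hx.1, hx.2, hy.1, hy.2];
       first | (norm_num; done) | (norm_num; push_cast [hLe]; field_simp; rw [hL]; push_cast [hLe]; ring))
  · rintro ⟨x, y⟩
    simp only [Fin.sum_univ_succ, Fin.sum_univ_zero, Matrix.cons_val_zero, Matrix.cons_val_succ,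
      unifDens_par_prod, unifDens_par_tail, mem_rSet, mem_colSet, Finset.mem_univ, and_true, Finset.card_univ]
    rcases flowOne_cases s hs x with hx | hx | hx <;> rcases flowOne_cases t ht y with hy | hy | hy <;>
      simp only [hx.1, hx.2, hy.1, hy.2, hC] <;> norm_num <;> push_cast [hLe] <;> field_simp

/-- **the certificate at `(1,−1)`**: `E(1,0) = R × all ⊔ col × R' ≼ all` (Harris on each part) -/
theorem cert_1m (hs : FlowOne s) (ht : FlowOne t) (ha : 0 < (rSet s).card) (ha' : 0 < (rSet t).card) :
    BlockDom (V2Closure.SP.par s t) (tailSet (V2Closure.SP.par s t) 1 0) (tailSet (V2Closure.SP.par s t) 0 0) := by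
  obtain ⟨-, hC, -, hn, hRne, -, hCne, -⟩ := counts s hs ha
  obtain ⟨-, -, -, hn', hR'ne, -, -, -⟩ := counts t ht ha'
  have hLe := card_rSet_le s; have hLe' := card_rSet_le t
  have hL := tailCount_par_10 s t hs ht
  have hN := tailCount_par_00 s t
  have hLq : (0 : ℚ) < (tailCount (V2Closure.SP.par s t) 1 0 : ℚ) := by exact_mod_cast tailCount_par_10_pos s t ha
  have hL0 : (tailCount (V2Closure.SP.par s t) 1 0 : ℚ) ≠ 0 := ne_of_gt hLq
  have ha0 : ((rSet s).card : ℚ) ≠ 0 := by exact_mod_cast ne_of_gt ha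
  have ha'0 : ((rSet t).card : ℚ) ≠ 0 := by exact_mod_cast ne_of_gt ha'
  have hn0 : (Fintype.card t.Conf : ℚ) ≠ 0 := by
    have := card_rSet_le t; exact_mod_cast ne_of_gt (lt_of_lt_of_le ha' this)
  have hm0 : (Fintype.card s.Conf : ℚ) ≠ 0 := by
    exact_mod_cast ne_of_gt (lt_of_lt_of_le ha hLe)
  have hd0 : (Fintype.card s.Conf : ℚ) - (rSet s).card ≠ 0 := by
    have : ((rSet s).card : ℚ) < Fintype.card s.Conf := by exact_mod_cast hn
    linarith
  refine blockDom_par_of_certificate s t ![rSet s, rSet s, colSet s] ![rSet s, colSet s, colSet s]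
      ![Finset.univ, Finset.univ, rSet t] ![Finset.univ, Finset.univ, Finset.univ]
      ![((rSet s).card * Fintype.card t.Conf : ℕ) / ((Fintype.card s.Conf * Fintype.card t.Conf : ℕ) : ℚ),
        ((rSet s).card * Fintype.card t.Conf * ((Fintype.card s.Conf - (rSet s).card) * (Fintype.card t.Conf - (rSet t).card)) : ℕ)
          / ((tailCount (V2Closure.SP.par s t) 1 0 * (Fintype.card s.Conf * Fintype.card t.Conf) : ℕ) : ℚ),
        ((Fintype.card s.Conf - (rSet s).card) * (rSet t).card : ℕ) / (tailCount (V2Closure.SP.par s t) 1 0 : ℕ)]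
      ?_ ?_ ?_ ?_ _ _ ?_ ?_
  · intro k; fin_cases k <;> simp <;> positivity
  · intro k; fin_cases k <;> simp [blockDom_refl, dom_r_col]
  · intro k; fin_cases k <;> simp [blockDom_refl, dom_r_univ]
  · intro k _ _
    rcases k with ⟨k, hk⟩
    interval_cases k
    · exact Finset.nonempty_product.2 ⟨hRne, Finset.univ_nonempty_iff.2 ⟨redConf t⟩⟩
    · exact Finset.nonempty_product.2 ⟨hCne, Finset.univ_nonempty_iff.2 ⟨redConf t⟩⟩
    · exact Finset.nonempty_product.2 ⟨hCne, Finset.univ_nonempty_iff.2 ⟨redConf t⟩⟩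
  · rintro ⟨x, y⟩
    simp only [Fin.sum_univ_succ, Fin.sum_univ_zero, Matrix.cons_val_zero, Matrix.cons_val_succ,
      unifDens_par_prod, unifDens_par_tail, mem_rSet, mem_colSet, Finset.mem_univ, and_true, Finset.card_univ]
    rcases flowOne_cases s hs x with hx | hx | hx <;> rcases flowOne_cases t ht y with hy | hy | hy <;>
      simp only [hx.1, hx.2, hy.1, hy.2, hC] <;> norm_num <;> push_cast [hLe, hLe'] <;> field_simp <;>
      (rw [hL]; push_cast [hLe, hLe']; ring)
  · rintro ⟨x, y⟩
    simp only [Fin.sum_univ_succ, Fin.sum_univ_zero, Matrix.cons_val_zero, Matrix.cons_val_succ,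
      unifDens_par_prod, unifDens_par_tail, mem_rSet, mem_colSet, Finset.mem_univ, and_true, Finset.card_univ, hN]
    rcases flowOne_cases s hs x with hx | hx | hx <;> rcases flowOne_cases t ht y with hy | hy | hy <;>
      simp only [hx.1, hx.2, hy.1, hy.2, hC] <;> norm_num <;> push_cast [hLe, hLe'] <;> field_simp <;>
      (rw [hL]; push_cast [hLe, hLe']; ring)

/-- **the axis member `(0,0)`**: `all ≼ E(0,1)` is Harris on the composition -/
theorem cert_00 : BlockDom (V2Closure.SP.par s t) (tailSet (V2Closure.SP.par s t) 0 0) (tailSet (V2Closure.SP.par s t) 0 1) := by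
  rw [tailSet_par_00]
  apply blockDom_univ_upper
  intro p q hpq hp
  rw [mem_tailSet_par'] at hp ⊢
  have := bLab_monotone (V2Closure.SP.par s t) hpq
  show 0 ≤ _ ∧ 1 ≤ _
  refine ⟨Nat.zero_le _, ?_⟩
  exact le_trans hp.2 this

end Certificates


section Main

variable (s t : V2Closure.SP)

/-- (SD) at a clipped position is trivial when the source or the target tail is empty -/
theorem sdomZ_of_empty_tail (u v : ℤ)
    (h : tailCount s u.toNat v.toNat = 0 ∨ tailCount s (u - 1).toNat (v + 1).toNat = 0) : SDomZ s u v := by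
  intro f hf
  rcases h with h | h
  · have e : tailSet s u.toNat v.toNat = ∅ := Finset.card_eq_zero.1 h
    simp [tailSum, e]
  · rw [h]; simp

/-- (SD) depends only on the clipped positions -/
theorem sdomZ_clip_congr {u v u' v' : ℤ} (h1 : u.toNat = u'.toNat) (h2 : (u - 1).toNat = (u' - 1).toNat)
    (h3 : v.toNat = v'.toNat) (h4 : (v + 1).toNat = (v' + 1).toNat) (h : SDomZ s u' v') : SDomZ s u v := by
  unfold SDomZ at h ⊢
  rw [h1, h2, h3, h4]
  exact h

/-- **(SD) at every clipped position on the parallel composition of two flow-one networks** (each with a red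
crossing): the seven certificates, Harris at `(0,0)`, the identity at `(0,−1)`, and the empty tails beyond the
total flow `2` -/
theorem sdomZ_flowOne_par (hs : FlowOne s) (ht : FlowOne t) (ha : 0 < (rSet s).card) (ha' : 0 < (rSet t).card)
    (u v : ℤ) : SDomZ (V2Closure.SP.par s t) u v := by
  have i20 : SDomZ (V2Closure.SP.par s t) 2 0 := by rw [sdomZ_iff_blockDom]; exact cert_20 s t hs ht ha ha'
  have i11 : SDomZ (V2Closure.SP.par s t) 1 1 := by rw [sdomZ_iff_blockDom]; exact cert_11 s t hs ht ha ha'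
  have i10 : SDomZ (V2Closure.SP.par s t) 1 0 := by rw [sdomZ_iff_blockDom]; exact cert_10 s t hs ht ha ha'
  have i00 : SDomZ (V2Closure.SP.par s t) 0 0 := by rw [sdomZ_iff_blockDom]; exact cert_00 s t
  have i01 : SDomZ (V2Closure.SP.par s t) 0 1 := by rw [sdomZ_iff_blockDom]; exact cert_01 s t hs ht ha ha'
  have i2m : SDomZ (V2Closure.SP.par s t) 2 (-1) := by rw [sdomZ_iff_blockDom]; exact cert_2m s t hs ht ha ha'
  have i1m : SDomZ (V2Closure.SP.par s t) 1 (-1) := by rw [sdomZ_iff_blockDom]; exact cert_1m s t hs ht ha ha'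
  have i0m : SDomZ (V2Closure.SP.par s t) 0 (-1) := by rw [sdomZ_iff_blockDom]; exact blockDom_refl _ _
  have big := tailCount_par_big s t hs ht
  rcases (show u ≤ 0 ∨ 0 < u by omega) with hu0 | hu0
  · rcases (show v ≤ -1 ∨ -1 < v by omega) with hv | hv
    · exact sdomZ_clip_congr _ (u' := 0) (v' := -1) (by omega) (by omega) (by omega) (by omega) i0m
    · rcases (show v = 0 ∨ v = 1 ∨ 2 ≤ v by omega) with hv | hv | hv
      · exact sdomZ_clip_congr _ (u' := 0) (v' := 0) (by omega) (by omega) (by omega) (by omega) i00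
      · exact sdomZ_clip_congr _ (u' := 0) (v' := 1) (by omega) (by omega) (by omega) (by omega) i01
      · exact sdomZ_of_empty_tail _ u v (Or.inr (big _ _ (by omega)))
  · rcases (show u = 1 ∨ u = 2 ∨ 3 ≤ u by omega) with hu | hu | hu
    · rcases (show v ≤ -1 ∨ -1 < v by omega) with hv | hv
      · exact sdomZ_clip_congr _ (u' := 1) (v' := -1) (by omega) (by omega) (by omega) (by omega) i1m
      · rcases (show v = 0 ∨ v = 1 ∨ 2 ≤ v by omega) with hv | hv | hv
        · exact sdomZ_clip_congr _ (u' := 1) (v' := 0) (by omega) (by omega) (by omega) (by omega) i10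
        · exact sdomZ_clip_congr _ (u' := 1) (v' := 1) (by omega) (by omega) (by omega) (by omega) i11
        · exact sdomZ_of_empty_tail _ u v (Or.inr (big _ _ (by omega)))
    · rcases (show v ≤ -1 ∨ -1 < v by omega) with hv | hv
      · exact sdomZ_clip_congr _ (u' := 2) (v' := -1) (by omega) (by omega) (by omega) (by omega) i2m
      · rcases (show v = 0 ∨ 1 ≤ v by omega) with hv | hv
        · exact sdomZ_clip_congr _ (u' := 2) (v' := 0) (by omega) (by omega) (by omega) (by omega) i20
        · exact sdomZ_of_empty_tail _ u v (Or.inl (big _ _ (by omega)))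
    · exact sdomZ_of_empty_tail _ u v (Or.inl (big _ _ (by omega)))

end Main


section Corollaries

variable (s t : V2Closure.SP)

/-- the tail-average monotonicity (T-AVG) at every position on `X ∥ Y` for flow-one factors -/
theorem tailAvg_flowOne_par (hs : FlowOne s) (ht : FlowOne t) (ha : 0 < (rSet s).card) (ha' : 0 < (rSet t).card)
    (a c : ℕ) : TailAvg (V2Closure.SP.par s t) a c :=
  tailAvg_of_sdomZ _ a c (sdomZ_flowOne_par s t hs ht ha ha' a c)

/-- the off-axis count inequality `#E(2,0) ≤ #E(1,1)` on `X ∥ Y` for flow-one factors -/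
theorem offaxis_flowOne_par_20 (hs : FlowOne s) (ht : FlowOne t) :
    tailCount (V2Closure.SP.par s t) 2 0 ≤ tailCount (V2Closure.SP.par s t) 1 1 := by
  rw [tailCount_par_20 s t hs ht, tailCount_par_11 s t hs ht]; omega

/-- **the Hall / monotone-relay form at `(2,0)`** on `X ∥ Y` for flow-one factors: every upper set carries
non-negative `phi 2 0`-mass, i.e. an injection `{r ≥ 2, b = 0} → {r = 1, b ≥ 1}` recolouring red edges blue -/
theorem hallFn_flowOne_par_20 (hs : FlowOne s) (ht : FlowOne t) (ha : 0 < (rSet s).card) (ha' : 0 < (rSet t).card) :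
    HallFn (phi 2 0) (V2Closure.SP.par s t).rLab (V2Closure.SP.par s t).bLab :=
  hallFn_phi_of_sdomZ 2 0 (by omega) (sdomZ_flowOne_par s t hs ht ha ha' 2 0) (offaxis_flowOne_par_20 s t hs ht)

end Corollaries

end Summit.Ventures.PercRepro2.Tail2D
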